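import Summits.Ventures.CertifiedManyBodySolver.Observables.PairLROTowerCeilingAuxStep
import Literature.MathematicalPhysics.QuantumLattice.HubbardNNNHoppingEnergyDensityConvex
import HarnessLib

/-!
# The sharp one-point ceiling WITH AUXILIARY CHORD ROWS: `liminf_k u_k ≤ M²` from (OP1) + Hamiltonian-difference
# letter boxes, discharged in the thermodynamic limit by ENERGY-DENSITY CHORDS

HONEST FRAMING: first certified bounds on pairing observables; not a superconductivity verdict. Crew hubbard-obs
(D-0042), seat hubbard-obs-p1 (`prover-hubbard-obs-p1-g14-0`). Zero compute; no definition; no named fact; no `sorry`.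
A CEILING at positivity scale never speaks to presence; no phase sentence.

PairLROTowerCeiling's `liminf_pairFieldLRO_le_sq_of_onePoint_variational_bound_TT'` turns a one-point variational
bound (OP1) — valid for EVERY unit vector of every large torus, with rows: constant, fillings `N_σ/L²`, energy
`H_L(θ)/L²` (`θ = (t,t',U)`) — into the Koma–Tasaki ceiling `liminf_k u_k ≤ M²` on the pair-field LRO of every
family of sector ground states at density `n`. A product / box certificate has MORE rows: letter boxes on
auxiliary densities (double occupancy `D/L²`, diagonal hopping `T₂/L²`, …). Along the Koma–Tasaki tower such
densities obey no operator identity, so a torus-limit density hypothesis on the tower would be inadmissible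
(pen RULING (hp) d260). The observation of PAIRCORR-SDP §21.7: when the auxiliary observable is a HAMILTONIAN
DIFFERENCE `(H_L(θ) − H_L(θ_j))/δ_j` (`U·D_L = H_L(t,t',U+1) − H_L(t,t',U)`, `−t'T₂ = …`; `H` is linear in
`(t,t',U)`), the tower controls it with NO new estimate: `⟨Ξ,H_L(θ)Ξ⟩ ≤ E + O(1)` is the existing energy
clause and `⟨Ξ,H_L(θ_j)Ξ⟩ ≥ min-over-levels sector ground energy of H_L(θ_j)` is the variational principle
(`tower_finite_step_aux`), whose density tends to `e(θ_j; n)` along the tower levels `N_L + 2m`, `m ≤ k`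
(tiling lower bound `energyDensityTT'_le_torus` + the supporting line of the convex `e(θ_j; ·)` at `n`).
* `exists_sectorFloorDensity_eventually` — for `U ≥ 0`, `0 < n < 2`, `K`: a sequence `f_L → e(t,t',U;n)` with
  `f_L·L² ≤ minEnergyOn H_L (szSector (N_L(n) + 2m) 0)` for all `m ≤ K`, eventually in `L`;
* **`liminf_pairFieldLRO_le_sq_of_onePoint_variational_bound_TT'_aux`** — (OP1) with auxiliary rows
  `Σ_j ρ_j (w_j − Re⟨ζ,(H_L(θ) − H_L(θ_j))ζ⟩/(δ_j L²))` (`ρ_j ≥ 0`, `δ_j > 0`, `U_j ≥ 0`) for all unit `ζ` of all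
  large tori, plus the CHORD premises `e(θ; n) − e(θ_j; n) ≤ δ_j w_j` (certified rows BY NAME at `θ` and `θ_j`),
  give `liminf_k u_k ≤ (c − A + (Σμ)(n/2 − ν))²` for every family of unit `(N_L(n), 0)`-sector ground states.
References: T. Koma, H. Tasaki, J. Stat. Phys. 76 (1994) 745, Theorem 5, §4 [KomaTasaki1994]; D. Ruelle,
Statistical Mechanics (1969) §3.3–3.4 [Ruelle1969]; J. Wang et al., PRX 14 (2024) 031006, §III [WangEtAl2024].
-/

noncomputable section

namespace Summit.Ventures.CertifiedManyBodySolver.Observables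

open Matrix Complex Finset Literature.MathematicalPhysics.QuantumLattice Literature.Probability.LatticeModels
open Literature.MathematicalPhysics.QuantumLattice.HubbardWave0 ThermodynamicLimit Filter Topology
open Literature.MathematicalPhysics.QuantumManyBody.StateRelaxation
open scoped ComplexOrder ComplexConjugate BigOperators

/-! ### §0  Uniform sector floors along the tower levels `N_L(n) + 2m`, `m ≤ K` -/

section Floor

/-- **Sector-floor densities along the tower levels.** For `U ≥ 0`, `0 < n < 2` and a tower height `K` there is
a real sequence `f_L → e(t, t', U; n)` with `f_L · L² ≤ minEnergyOn (hubbardTorusTT' L t t' U) (szSector (N_L(n) + 2m) 0)`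
for all `m ≤ K` and all large `L` (`N_L(n) = rectN n L`): the tiling lower bound
`e(2m'/L²) ≤ E_L(2m')/L² + (16|t| + 32|t'|)/L` (`energyDensityTT'_le_torus`), Lieb's `E_L(2m') = minEnergyOn (2m', 0)`,
and the supporting line of the convex density `e(·)` at `n` (`exists_supporting_line_energyDensityTT'`), with
`|(N_L + 2m)/L² − n| ≤ |N_L/L² − n| + 2K/L² → 0`. [cite: Ruelle1969, §3.3] [cite: KomaTasaki1994, §4] -/
theorem exists_sectorFloorDensity_eventually (t t' : ℝ) {U : ℝ} (hU : 0 ≤ U) {n : ℝ} (hn0 : 0 < n) (hn2 : n < 2)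
    (K : ℕ) :
    ∃ f : ℕ → ℝ, Tendsto f atTop (𝓝 (energyDensityTT' t t' U n)) ∧
      ∀ᶠ L : ℕ in atTop, ∀ m : ℕ, m ≤ K →
        f L * (L : ℝ) ^ 2 ≤ (hubbardTorusTT' L t t' U).minEnergyOn (szSector (rectN n L + 2 * m) 0) := by
  obtain ⟨s, hs⟩ := exists_supporting_line_energyDensityTT' t t' hU hn0 hn2
  set e₀ : ℝ := energyDensityTT' t t' U n with he₀
  set C : ℝ := 16 * |t| + 32 * |t'| with hC
  set err : ℕ → ℝ := fun L => |(rectN n L : ℝ) / (L : ℝ) ^ 2 - n| + 2 * K / (L : ℝ) ^ 2 with herr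
  refine ⟨fun L => e₀ - |s| * err L - C / L, ?_, ?_⟩
  · -- the limit
    have h1 : Tendsto (fun L : ℕ => |(rectN n L : ℝ) / (L : ℝ) ^ 2 - n|) atTop (𝓝 0) := by
      have h := ((tendsto_rectN_div_sq hn0.le).sub_const n).abs
      rwa [sub_self, abs_zero] at h
    have hL : Tendsto (fun L : ℕ => (L : ℝ)) atTop atTop := tendsto_natCast_atTop_atTop
    have h2 : Tendsto (fun L : ℕ => 2 * (K : ℝ) / (L : ℝ) ^ 2) atTop (𝓝 0) := by
      have h := ((tendsto_pow_atTop (α := ℝ) two_ne_zero).comp hL).inv_tendsto_atTop.const_mul (2 * (K : ℝ))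
      rw [mul_zero] at h
      refine h.congr' (Eventually.of_forall fun L => ?_)
      simp [div_eq_mul_inv]
    have h3 : Tendsto (fun L : ℕ => C / (L : ℝ)) atTop (𝓝 0) := by
      have h := hL.inv_tendsto_atTop.const_mul C
      rw [mul_zero] at h
      refine h.congr' (Eventually.of_forall fun L => ?_)
      simp [div_eq_mul_inv]
    have h4 : Tendsto err atTop (𝓝 (0 + 0)) := h1.add h2
    rw [add_zero] at h4
    have h5 := (tendsto_const_nhds (x := e₀)).sub (h4.const_mul |s|) |>.sub h3
    simpa using h5
  · -- the floor, eventually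
    obtain ⟨L₀, hL₀⟩ := exists_nat_gt (2 * (K : ℝ) / (2 - n))
    filter_upwards [Filter.eventually_ge_atTop (max L₀ 1)] with L hL m hm
    have hL1 : 1 ≤ L := le_trans (le_max_right _ _) hL
    have hLL₀ : (L₀ : ℝ) ≤ L := by exact_mod_cast le_trans (le_max_left _ _) hL
    haveI : NeZero L := ⟨by omega⟩
    have hLr : (0 : ℝ) < (L : ℝ) := by exact_mod_cast hL1
    have hL2 : (0 : ℝ) < (L : ℝ) ^ 2 := by positivity
    have h2n : 0 < 2 - n := by linarith
    -- the level `m' = ⌊nL²/2⌋ + m` is below `L²`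
    set m' : ℕ := ⌊n * (L : ℝ) ^ 2 / 2⌋₊ + m with hm'
    have hfloor : (⌊n * (L : ℝ) ^ 2 / 2⌋₊ : ℝ) ≤ n * (L : ℝ) ^ 2 / 2 := Nat.floor_le (by positivity)
    have hL1r : (1 : ℝ) ≤ (L : ℝ) := by exact_mod_cast hL1
    have hKL : 2 * (K : ℝ) < (2 - n) * (L : ℝ) ^ 2 := by
      have h1 : 2 * (K : ℝ) < (2 - n) * L₀ := by
        have := (div_lt_iff₀ h2n).1 hL₀
        linarith
      have h2 : (2 - n) * (L₀ : ℝ) ≤ (2 - n) * (L : ℝ) ^ 2 :=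
        mul_le_mul_of_nonneg_left (hLL₀.trans (by nlinarith [hL1r])) h2n.le
      linarith
    have hm'lt : m' < L * L := by
      have h : (m' : ℝ) < (L : ℝ) ^ 2 := by
        rw [hm']; push_cast
        have : (m : ℝ) ≤ K := by exact_mod_cast hm
        nlinarith
      have h' : (m' : ℝ) < ((L * L : ℕ) : ℝ) := by push_cast; nlinarith
      exact_mod_cast h'
    have hm'le : m' ≤ Fintype.card (FermionTorus 2 L) := by
      rw [show Fintype.card (FermionTorus 2 L) = L ^ 2 by simp, sq]; exact hm'lt.le
    have hN : rectN n L + 2 * m = 2 * m' := by simp only [rectN, hm']; ring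
    rw [hN, ← groundEnergy_hubbardTorusTT'_eq_minEnergyOn_szSector L t t' U hm'le]
    -- tiling lower bound and supporting line
    have htile := energyDensityTT'_le_torus t t' hU hL1 hm'lt
    set x : ℝ := ((2 * m' : ℕ) : ℝ) / (L : ℝ) ^ 2 with hx
    have hx0 : 0 ≤ x := by positivity
    have hx2 : x < 2 := by
      rw [hx, div_lt_iff₀ hL2]
      have h' : ((2 * m' : ℕ) : ℝ) < 2 * ((L * L : ℕ) : ℝ) := by exact_mod_cast (by omega : 2 * m' < 2 * (L * L))
      push_cast at h' ⊢
      nlinarith [h']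
    have hsup := hs x ⟨hx0, hx2⟩
    have hxn : |x - n| ≤ err L := by
      have e : x = (rectN n L : ℝ) / (L : ℝ) ^ 2 + 2 * (m : ℝ) / (L : ℝ) ^ 2 := by
        rw [hx, ← hN, Nat.cast_add, Nat.cast_mul, Nat.cast_ofNat, add_div]
      rw [e, herr]
      have hmK : 2 * (m : ℝ) / (L : ℝ) ^ 2 ≤ 2 * (K : ℝ) / (L : ℝ) ^ 2 :=
        div_le_div_of_nonneg_right (by have h : (m : ℝ) ≤ K := (by exact_mod_cast hm); linarith) hL2.le
      have hm0 : 0 ≤ 2 * (m : ℝ) / (L : ℝ) ^ 2 := by positivity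
      calc |(rectN n L : ℝ) / (L : ℝ) ^ 2 + 2 * (m : ℝ) / (L : ℝ) ^ 2 - n|
          = |((rectN n L : ℝ) / (L : ℝ) ^ 2 - n) + 2 * (m : ℝ) / (L : ℝ) ^ 2| := by ring_nf
        _ ≤ |(rectN n L : ℝ) / (L : ℝ) ^ 2 - n| + |2 * (m : ℝ) / (L : ℝ) ^ 2| := abs_add_le _ _
        _ ≤ |(rectN n L : ℝ) / (L : ℝ) ^ 2 - n| + 2 * (K : ℝ) / (L : ℝ) ^ 2 := by
            rw [abs_of_nonneg hm0]; linarith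
    have hsx : -(|s| * err L) ≤ s * (x - n) := by
      have h1 : -(|s| * |x - n|) ≤ s * (x - n) := by
        rw [← abs_mul]; exact neg_abs_le _
      have h2 : |s| * |x - n| ≤ |s| * err L := mul_le_mul_of_nonneg_left hxn (abs_nonneg s)
      linarith
    -- assemble: `e₀ - |s| err - C/L ≤ e(x) - C/L ≤ E/L²`
    have hE : e₀ - |s| * err L - C / L ≤ groundEnergy (hubbardTorusTT' L t t' U) (2 * m') / (L : ℝ) ^ 2 := by
      linarith [hsup, hsx, htile]
    have := (le_div_iff₀ hL2).1 hE
    linarith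

end Floor

/-! ### §1  Families of sector ground states: the sharp ceiling with auxiliary chord rows -/

section Family

variable (g : Site 2 → ℝ)

/-- **A certified one-point bound with auxiliary CHORD rows is the ceiling `liminf u_k ≤ M²`, `t–t'` model.**
Let `U ≥ 0`, `0 < n < 2`, `κ ≥ 0`, `e(t,t',U;n) ≤ u`, and a finite family of auxiliary parameter points
`θ_j = (t_j, t'_j, U_j)` (`U_j ≥ 0`) with weights `ρ_j ≥ 0`, scales `δ_j > 0`, targets `w_j` and the CHORD
premises `e(t,t',U;n) − e(t_j,t'_j,U_j;n) ≤ δ_j w_j`. Suppose the one-point bound with auxiliary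
Hamiltonian-difference rows
`c − A + Σ_σ μ_σ(Re⟨ζ,N_σζ⟩/L² − ν) + κ(u − Re⟨ζ,H_L(θ)ζ⟩/L²) + Σ_j ρ_j(w_j − Re⟨ζ,(H_L(θ) − H_L(θ_j))ζ⟩/(δ_jL²))
 ≤ −Re⟨ζ,Δ_gζ⟩/L²` holds for every unit vector `ζ` of every torus of side `L ≥ L₁`. Then every family of unit
`(rectN n L, S^z = 0)`-sector ground states of `H_L(θ) = hubbardTorusTT' L t t' U` has
`liminf_k u_k ≤ (c − A + (Σ_σ μ_σ)(n/2 − ν))²`. No torus-limit density hypothesis on the tower is used: the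
auxiliary rows are controlled by the energy clause of the tower and the variational principle in the shifted
sectors (`tower_finite_step_aux`, `exists_sectorFloorDensity_eventually`), and vanish in the limit by the chords.
[cite: KomaTasaki1994, Theorem 5] [cite: Ruelle1969, §3.4] [cite: WangEtAl2024, §III] -/
theorem liminf_pairFieldLRO_le_sq_of_onePoint_variational_bound_TT'_aux (t t' : ℝ) {U n : ℝ} (hU : 0 ≤ U)
    (hn0 : 0 < n) (hn2 : n < 2) {c A κ u ν : ℝ} (μ : Fin 2 → ℝ) (hκ : 0 ≤ κ)
    (hu : energyDensityTT' t t' U n ≤ u)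
    {ι : Type*} [Fintype ι] (ta tpa Ua δ ρ w : ι → ℝ) (hUa : ∀ j, 0 ≤ Ua j) (hδ : ∀ j, 0 < δ j)
    (hρ : ∀ j, 0 ≤ ρ j)
    (hw : ∀ j, energyDensityTT' t t' U n - energyDensityTT' (ta j) (tpa j) (Ua j) n ≤ δ j * w j)
    (L₁ : ℕ)
    (hbound : ∀ (L : ℕ) [NeZero L], L₁ ≤ L → ∀ ζ : Fock (Orb (FermionTorus 2 L)), star ζ ⬝ᵥ ζ = 1 →
      c - A + ∑ σ : Fin 2, μ σ *
          ((star ζ ⬝ᵥ ((∑ y : FermionTorus 2 L, numberOp y σ) *ᵥ ζ)).re / (L : ℝ) ^ 2 - ν) +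
        κ * (u - (star ζ ⬝ᵥ (hubbardTorusTT' L t t' U *ᵥ ζ)).re / (L : ℝ) ^ 2) +
        ∑ j, ρ j * (w j -
          (star ζ ⬝ᵥ ((hubbardTorusTT' L t t' U - hubbardTorusTT' L (ta j) (tpa j) (Ua j)) *ᵥ ζ)).re /
            (δ j * (L : ℝ) ^ 2)) ≤
        -((expect (pairField g L) ζ).re / (L : ℝ) ^ 2))
    (ψ : ∀ L, Fock (Orb (FermionTorus 2 L)))
    (hψ : ∀ L, IsGroundStateInSector (hubbardTorusTT' L t t' U) (rectN n L) 0 (ψ L))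
    (hψ1 : ∀ L, star (ψ L) ⬝ᵥ ψ L = 1) :
    liminf (fun k : ℕ => (∑ x ∈ halfOpenBox 2 (2 * k), ∑ y ∈ halfOpenBox 2 (2 * k),
        torusPullback (pairFieldCorr g ψ) (2 * k) x y) / ((#(halfOpenBox 2 (2 * k)) : ℝ)) ^ 2) atTop ≤
      (c - A + (∑ σ : Fin 2, μ σ) * (n / 2 - ν)) ^ 2 := by
  have hn0' : 0 ≤ n := hn0.le
  obtain ⟨Cγ, Lγ, hCγ, hγ⟩ := exists_abs_re_expect_commutator_pairField_le g
  obtain ⟨Cα, Lα, hCα, hα⟩ := exists_eucNorm_pairField_conjTranspose_mulVec_le g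
  obtain ⟨Cκ, Lκ, hCκ, hκ'⟩ := exists_eucNorm_commutator_hubbardTorusTT'_pairField_conjTranspose_mulVec_le g t t' U
  set M : ℝ := -(c - A + (∑ σ : Fin 2, μ σ) * (n / 2 - ν)) with hM
  have hM2 : (c - A + (∑ σ : Fin 2, μ σ) * (n / 2 - ν)) ^ 2 = M ^ 2 := by rw [hM, neg_sq]
  rw [hM2]
  set useq : ℕ → ℝ := fun k => (∑ x ∈ halfOpenBox 2 (2 * k), ∑ y ∈ halfOpenBox 2 (2 * k),
      torusPullback (pairFieldCorr g ψ) (2 * k) x y) / ((#(halfOpenBox 2 (2 * k)) : ℝ)) ^ 2 with huseq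
  change liminf useq atTop ≤ M ^ 2
  set vseq : ℕ → ℝ := fun m =>
    (expect ((pairField g (m + 1))ᴴ * pairField g (m + 1)) (ψ (m + 1))).re / (((m + 1 : ℕ) : ℝ)) ^ 4
    with hvseq
  have hterm : ∀ k : ℕ, 1 ≤ k → ∃ m : ℕ, 2 * k = m + 1 ∧ useq k = vseq m := by
    intro k hk
    obtain ⟨m, hm⟩ : ∃ m, 2 * k = m + 1 := ⟨2 * k - 1, by omega⟩
    refine ⟨m, hm, ?_⟩
    simp only [huseq, hvseq]
    rw [hm, torusLROSeq_pairFieldCorr_succ]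
  have hvnonneg : ∀ m : ℕ, 0 ≤ vseq m := fun m => by
    simp only [hvseq]
    refine div_nonneg ?_ (by positivity)
    exact (Complex.nonneg_iff.1
      ((Matrix.posSemidef_conjTranspose_mul_self (pairField g (m + 1))).dotProduct_mulVec_nonneg
        (ψ (m + 1)))).1
  have hnonneg : ∀ k : ℕ, 1 ≤ k → 0 ≤ useq k := fun k hk => by
    obtain ⟨m, -, heq⟩ := hterm k hk
    rw [heq]
    exact hvnonneg m
  have hbdd : IsBoundedUnder (· ≥ ·) atTop useq :=
    isBoundedUnder_of_eventually_ge (a := 0) (Filter.eventually_atTop.2 ⟨1, fun k hk => hnonneg k hk⟩)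
  by_contra hcon
  rw [not_le] at hcon
  obtain ⟨c₀, hc₀M, hc₀lim⟩ := exists_between hcon
  have hc₀ : 0 < c₀ := lt_of_le_of_lt (sq_nonneg M) hc₀M
  have hev : ∀ᶠ k : ℕ in atTop, c₀ < useq k := eventually_lt_of_lt_liminf hc₀lim hbdd
  -- the tower height: `(kt/(kt+1))·√c₀ > M`
  have hsqrt_pos : 0 < Real.sqrt c₀ := Real.sqrt_pos.2 hc₀
  have hMlt : M < Real.sqrt c₀ := by
    have h1 : |M| < Real.sqrt c₀ := by
      rw [← Real.sqrt_sq_eq_abs]; exact Real.sqrt_lt_sqrt (sq_nonneg M) hc₀M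
    exact lt_of_le_of_lt (le_abs_self M) h1
  obtain ⟨kt, hkt⟩ : ∃ kt : ℕ, M < (kt : ℝ) / (kt + 1) * Real.sqrt c₀ := by
    set δ' : ℝ := 1 - M / Real.sqrt c₀ with hδ'
    have hδpos : 0 < δ' := by
      rw [hδ', sub_pos, div_lt_one hsqrt_pos]; exact hMlt
    obtain ⟨kt, hkt⟩ := exists_nat_gt (1 / δ')
    refine ⟨kt, ?_⟩
    have hk1 : (0 : ℝ) < kt + 1 := by positivity
    have h1 : 1 / ((kt : ℝ) + 1) < δ' := by
      rw [div_lt_iff₀ hk1]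
      have : 1 / δ' * δ' = 1 := by field_simp
      nlinarith [hkt, hδpos]
    have h2 : (kt : ℝ) / (kt + 1) = 1 - 1 / (kt + 1) := by field_simp; ring
    rw [h2]
    have h3 : M / Real.sqrt c₀ < 1 - 1 / ((kt : ℝ) + 1) := by rw [hδ'] at h1; linarith
    have := (div_lt_iff₀ hsqrt_pos).1 h3
    linarith
  -- the sector-floor densities of the auxiliary Hamiltonians along the tower levels
  have hfl : ∀ j, ∃ f : ℕ → ℝ, Tendsto f atTop (𝓝 (energyDensityTT' (ta j) (tpa j) (Ua j) n)) ∧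
      ∀ᶠ L : ℕ in atTop, ∀ m : ℕ, m ≤ kt → f L * (L : ℝ) ^ 2 ≤
        (hubbardTorusTT' L (ta j) (tpa j) (Ua j)).minEnergyOn (szSector (rectN n L + 2 * m) 0) :=
    fun j => exists_sectorFloorDensity_eventually (ta j) (tpa j) (hUa j) hn0 hn2 kt
  choose f hf_lim hf_ev using hfl
  have hf_all : ∀ᶠ L : ℕ in atTop, ∀ j, ∀ m : ℕ, m ≤ kt → f j L * (L : ℝ) ^ 2 ≤
      (hubbardTorusTT' L (ta j) (tpa j) (Ua j)).minEnergyOn (szSector (rectN n L + 2 * m) 0) :=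
    Filter.eventually_all.2 hf_ev
  set Dbar : ℝ := (Cκ / Real.sqrt (c₀ / 2)) * ∑ i ∈ Finset.range kt, (Cα / Real.sqrt (c₀ / 2)) ^ i with hDbar
  set K : ℝ := -(∑ σ : Fin 2, μ σ) * kt / 2 + (κ + ∑ j, ρ j / δ j) * Dbar with hK
  obtain ⟨L₂, hL₂⟩ : ∃ L₂ : ℕ, ∀ L : ℕ, L₂ ≤ L → ((kt : ℝ) + 1) * Cγ ≤ (c₀ / 2) * (L : ℝ) ^ 2 := by
    obtain ⟨L₂, hL₂⟩ := exists_nat_ge (((kt : ℝ) + 1) * Cγ / (c₀ / 2))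
    refine ⟨max L₂ 1, fun L hL => ?_⟩
    have hL1 : (1 : ℝ) ≤ L := by exact_mod_cast le_trans (le_max_right _ _) hL
    have hLL : (L₂ : ℝ) ≤ L := by exact_mod_cast le_trans (le_max_left _ _) hL
    have hc2 : 0 < c₀ / 2 := by linarith
    have h1 : ((kt : ℝ) + 1) * Cγ ≤ (c₀ / 2) * L := by
      rw [div_le_iff₀ hc2] at hL₂; nlinarith
    have h2 : (c₀ / 2) * (L : ℝ) ≤ (c₀ / 2) * (L : ℝ) ^ 2 := by
      have : (L : ℝ) ≤ (L : ℝ) ^ 2 := by nlinarith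
      exact mul_le_mul_of_nonneg_left this hc2.le
    linarith
  have h2k : Tendsto (fun k : ℕ => 2 * k) atTop atTop := Filter.tendsto_id.const_mul_atTop' (by norm_num)
  set Lr : ℕ → ℝ := fun k => ((2 * k : ℕ) : ℝ) with hLr
  set Eseq : ℕ → ℝ := fun k =>
    groundEnergy (hubbardTorusTT' (2 * k) t t' U) (rectN n (2 * k)) / ((2 * k : ℕ) : ℝ) ^ 2 with hEseq
  set Nseq : ℕ → ℝ := fun k => (rectN n (2 * k) : ℝ) / ((2 * k : ℕ) : ℝ) ^ 2 with hNseq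
  set lhs : ℕ → ℝ := fun k => (kt : ℝ) / (kt + 1) * Real.sqrt (c₀ - (kt + 1) * Cγ / Lr k ^ 2) with hlhs
  set rhs : ℕ → ℝ := fun k =>
    -(c - A + (∑ σ : Fin 2, μ σ) * (Nseq k / 2 - ν) + κ * (u - Eseq k) +
        ∑ j, ρ j * (w j - (Eseq k - f j (2 * k)) / δ j)) + K / Lr k ^ 2 with hrhs
  -- the finite-volume tower step, eventually in `k`
  have hstep : ∀ᶠ k : ℕ in atTop, lhs k ≤ rhs k := by
    filter_upwards [hev, h2k.eventually hf_all,
      Filter.eventually_ge_atTop (max 1 (max L₁ (max Lγ (max Lα (max Lκ L₂)))))] with k hk hkf hkL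
    have hk1 : 1 ≤ k := le_trans (le_max_left _ _) hkL
    obtain ⟨m, hm, heq⟩ := hterm k hk1
    simp only [max_le_iff] at hkL
    obtain ⟨-, hkL₁, hkγ, hkα, hkκ, hk₂⟩ := hkL
    have hmL₁ : L₁ ≤ m + 1 := by omega
    have hmγ : Lγ ≤ m + 1 := by omega
    have hmα : Lα ≤ m + 1 := by omega
    have hmκ : Lκ ≤ m + 1 := by omega
    have hm₂ : L₂ ≤ m + 1 := by omega
    have hlro : c₀ * (((m + 1 : ℕ) : ℝ)) ^ 4 ≤
        (expect ((pairField g (m + 1))ᴴ * pairField g (m + 1)) (ψ (m + 1))).re := by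
      have h := hk.le
      rw [heq] at h
      simp only [hvseq] at h
      rwa [le_div_iff₀ (by positivity)] at h
    rw [hm] at hkf
    have h := tower_finite_step_aux g t t' U (hψ1 (m + 1)) (hψ (m + 1)) μ hκ hc₀ hCα hCκ hCγ kt
      ta tpa Ua δ ρ w (fun j => f j (m + 1)) hδ hρ hkf
      (hα (m + 1) hmα) (hκ' (m + 1) hmκ) (hγ (m + 1) hmγ) hlro (hL₂ (m + 1) hm₂) (hbound (m + 1) hmL₁)
    have hcard : ⌊n * (((m + 1 : ℕ)) : ℝ) ^ 2 / 2⌋₊ ≤ Fintype.card (FermionTorus 2 (m + 1)) := by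
      rw [show Fintype.card (FermionTorus 2 (m + 1)) = (m + 1) ^ 2 by simp]
      have h2 := rectN_le_two_mul hn0' hn2.le (m + 1)
      simp only [rectN] at h2
      have e : (m + 1) ^ 2 = (m + 1) * (m + 1) := by ring
      rw [e]
      exact Nat.le_of_mul_le_mul_left h2 (by norm_num)
    have hE : (hubbardTorusTT' (m + 1) t t' U).minEnergyOn (szSector (rectN n (m + 1)) 0) =
        groundEnergy (hubbardTorusTT' (m + 1) t t' U) (rectN n (m + 1)) := by
      simp only [rectN]
      rw [groundEnergy_hubbardTorusTT'_eq_minEnergyOn_szSector (m + 1) t t' U hcard]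
    rw [hE, ← hDbar, ← hK] at h
    have e1 : ((rectN n (m + 1) : ℕ) : ℝ) / 2 / (((m + 1 : ℕ) : ℝ)) ^ 2 =
        ((rectN n (m + 1) : ℕ) : ℝ) / (((m + 1 : ℕ) : ℝ)) ^ 2 / 2 := div_right_comm _ _ _
    rw [e1] at h
    simp only [hlhs, hrhs, hLr, hNseq, hEseq]
    rw [hm]
    exact h
  have hLr_top : Tendsto Lr atTop atTop := tendsto_natCast_atTop_atTop.comp h2k
  have hLr2 : Tendsto (fun k => (Lr k ^ 2)⁻¹) atTop (𝓝 0) :=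
    ((tendsto_pow_atTop (α := ℝ) two_ne_zero).comp hLr_top).inv_tendsto_atTop
  have hlhs_lim : Tendsto lhs atTop (𝓝 ((kt : ℝ) / (kt + 1) * Real.sqrt c₀)) := by
    have h1 : Tendsto (fun k => c₀ - (kt + 1) * Cγ * (Lr k ^ 2)⁻¹) atTop (𝓝 (c₀ - (kt + 1) * Cγ * 0)) :=
      tendsto_const_nhds.sub (hLr2.const_mul _)
    rw [mul_zero, sub_zero] at h1
    have h2 := (h1.sqrt).const_mul ((kt : ℝ) / (kt + 1))
    refine h2.congr' (Eventually.of_forall fun k => ?_)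
    simp [hlhs, div_eq_mul_inv, mul_assoc]
  have hE_lim : Tendsto Eseq atTop (𝓝 (energyDensityTT' t t' U n)) :=
    (tendsto_energyDensityTT'_torus t t' hU hn0' hn2).comp h2k
  have hN_lim : Tendsto Nseq atTop (𝓝 n) := (tendsto_rectN_div_sq hn0').comp h2k
  have hf_lim2 : ∀ j, Tendsto (fun k => f j (2 * k)) atTop (𝓝 (energyDensityTT' (ta j) (tpa j) (Ua j) n)) :=
    fun j => (hf_lim j).comp h2k
  have hS_lim : Tendsto (fun k => ∑ j, ρ j * (w j - (Eseq k - f j (2 * k)) / δ j)) atTop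
      (𝓝 (∑ j, ρ j * (w j - (energyDensityTT' t t' U n - energyDensityTT' (ta j) (tpa j) (Ua j) n) / δ j))) :=
    tendsto_finsetSum _ fun j _ =>
      (tendsto_const_nhds.sub ((hE_lim.sub (hf_lim2 j)).div_const (δ j))).const_mul (ρ j)
  have hrhs_lim : Tendsto rhs atTop
      (𝓝 (-(c - A + (∑ σ : Fin 2, μ σ) * (n / 2 - ν) + κ * (u - energyDensityTT' t t' U n) +
        ∑ j, ρ j * (w j - (energyDensityTT' t t' U n - energyDensityTT' (ta j) (tpa j) (Ua j) n) / δ j)) +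
        K * 0)) := by
    have h1 : Tendsto (fun k => -(c - A + (∑ σ : Fin 2, μ σ) * (Nseq k / 2 - ν) + κ * (u - Eseq k) +
        ∑ j, ρ j * (w j - (Eseq k - f j (2 * k)) / δ j)))
        atTop (𝓝 (-(c - A + (∑ σ : Fin 2, μ σ) * (n / 2 - ν) + κ * (u - energyDensityTT' t t' U n) +
          ∑ j, ρ j * (w j - (energyDensityTT' t t' U n - energyDensityTT' (ta j) (tpa j) (Ua j) n) / δ j)))) :=
      (((tendsto_const_nhds.add (((hN_lim.div_const 2).sub tendsto_const_nhds).const_mul _)).add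
        ((tendsto_const_nhds.sub hE_lim).const_mul κ)).add hS_lim).neg
    have h2 := h1.add (hLr2.const_mul K)
    refine h2.congr' (Eventually.of_forall fun k => ?_)
    simp [hrhs, div_eq_mul_inv]
  have hle := le_of_tendsto_of_tendsto hlhs_lim hrhs_lim hstep
  rw [mul_zero, add_zero] at hle
  have hslack : 0 ≤ κ * (u - energyDensityTT' t t' U n) := mul_nonneg hκ (sub_nonneg.2 hu)
  have haux : 0 ≤ ∑ j, ρ j *
      (w j - (energyDensityTT' t t' U n - energyDensityTT' (ta j) (tpa j) (Ua j) n) / δ j) := by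
    refine Finset.sum_nonneg fun j _ => mul_nonneg (hρ j) (sub_nonneg.2 ?_)
    rw [div_le_iff₀ (hδ j), mul_comm]
    exact hw j
  have : (kt : ℝ) / (kt + 1) * Real.sqrt c₀ ≤ M := by linarith [hM, hle, hslack, haux]
  linarith

end Family

end Summit.Ventures.CertifiedManyBodySolver.Observables

end
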